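import Summits.BirchSwinnertonDyer.BirchSwinnertonDyer.Theorems.TeichmullerTwistDescentKOfMackeyFunctional
import Summits.BirchSwinnertonDyer.BirchSwinnertonDyer.Theorems.TeichmullerTwistDescentOrdinaryLowValuationOfSaturation
import Summits.BirchSwinnertonDyer.BirchSwinnertonDyer.Theorems.TeichmullerTwistDescentNeronLatticeTwistPStarOfLowValuation
import HarnessLib

/-!
# Route `TeichmullerTwistDescent`: GE11 `OrdinaryLowValuationOptimalManinUnitGeEleven` (stmt-BirchSwinnertonDyer-23885)
# from modularity, Edixhoven's Kodaira-type theorem, the EXPLICIT automorphic input (I1⁗: a twisted Borel period sum of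
# `f_D` is nonzero) and the Ash–Stevens weight exclusion (W‴)

Cell `pub/bsd-wall` (D-0145 line route-BirchSwinnertonDyer-TeichmullerTwistDescent, OPEN rev 7), seat `bsd-line-ttd-p1`
(prover 1/2, g25).  THEOREMS ONLY; `--supports stmt-BirchSwinnertonDyer-25368`.  A CLOSURE CERTIFICATE, not a closing file:
BSD is not proved; GE11 / K are NOT proved (conditional); nothing here closes an item.  Companion of the certificates
`TeichmullerTwistDescentGE11OfInputs` (I1″/W″) and `…GE11OfBorelInputs` (I1‴/W‴) with the explicit input (I1⁗)
`TwistedBorelPeriodSumNonvanishing` of `TeichmullerTwistDescentMackeyDefs` and (W‴) `NoEtaleWeightEigenQuotient` of `TeichmullerTwistDescentCarrierDefs` (both statements about the group homology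
`H₁(Γ₀(M), ℤ_p[GL₂(𝔽_p)])`, its `GL₂(𝔽_p)`-action and its Hecke operators `T_q`): the `p ≥ 11` potentially ordinary II/III/IV
optimal Manin statement GE11 (Edixhoven 1991 §4 «case 2») holds GRANTED modularity, Edixhoven 1991 Thm. 3 outside II/III/IV,
(I1⁗) [a Mackey/twisted Borel sum of spread period classes of `f_W` is nonzero ⟺ the tame principal series occurs: local Langlands / Carayol at `p`] and (W‴) [`Sym^{2b} ⊗ det^{−b}` is not a weight of
`ρ̄_W`: Ash–Stevens + Deligne / Fontaine / Edixhoven weight minimality]. [cite: EdixhovenManin1991, §4 and Thm. 3]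
[cite: Stevens1989, Lemma (5.2)] [cite: AshStevens1986, Thm. 3.5]
-/

set_option autoImplicit false
-- single-conjunct summit: `Summit.BirchSwinnertonDyer.BirchSwinnertonDyer.…` repeats the name by design
set_option linter.dupNamespace false

noncomputable section

namespace Summit.BirchSwinnertonDyer.BirchSwinnertonDyer.Theorems.TeichmullerTwistDescent

open Literature.NumberTheory.EllipticCurves.ModularForms
open Summit.BirchSwinnertonDyer.BirchSwinnertonDyer.Theses.TeichmullerTwistDescent

namespace KOfMackeyFunctional

/-- **GE11 from modularity, Edixhoven's theorem, the explicit period input and the weight exclusion.**  `OrdinaryLowValuationOptimalManinUnitGeEleven` (the route decl, verbatim) follows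
from modularity, Edixhoven's Kodaira-type theorem, the twisted Borel period sum (I1⁗) and the
Ash–Stevens weight exclusion (W‴), through K (`twistedPeriodLatticeSaturation_of_mackey_of_noEtaleWeightEigenQuotient`), the
proved Néron twist lemma and the proved LINE 11 glue.  BSD is not proved by this; GE11 is proved CONDITIONALLY on the four
named hypotheses. [cite: EdixhovenManin1991, §4 and Thm. 3] [cite: Stevens1989, Lemma (5.2)] -/
theorem ordinaryLowValuationOptimalManinUnitGeEleven_of_mackey_inputs (hnf : exists_isNewformOf)
    (hEdix : edixhoven_not_dvd_maninConstant_of_kodairaSymbol_ne)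
    (hM : TwistedBorelPeriodSumNonvanishing) (hW : NoEtaleWeightEigenQuotient) :
    OrdinaryLowValuationOptimalManinUnitGeEleven :=
  ordinaryLowValuationOfSaturation_proof
    (twistedPeriodLatticeSaturation_of_mackey_of_noEtaleWeightEigenQuotient hnf hM hW)
    neronLatticeTwistPStarOfLowValuation_proof ⟨hEdix, hnf⟩

end KOfMackeyFunctional

end Summit.BirchSwinnertonDyer.BirchSwinnertonDyer.Theorems.TeichmullerTwistDescent
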